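import Literature.MathematicalPhysics.QuantumFieldTheory.Balaban1983to89.B2Eq334ZetaPrimeKnit

/-!
# `Balaban1983to89.B2Eq341ZetaDoublePrimeKnit` — [Balaban1982Higgs2] (3.41) p. 592: r14's TYPED ζ″_{Λ₀⁽ᵏ⁾}
(`B2Eq341Zeta.zeta341`, the sum over the minimal admissible tuples of the six per-sort small factors) REWRITTEN as
the family sum `Σ_τ w_τ · (e^{−¼γ₀p(Lᵏε)²|Q_v⁽ᵏ⁾(τ)|}·e^{−¼γ₀p(Lᵏε)²|R_v⁽ᵏ⁾(τ)|}) · (e^{−⅛ap(Lᵏε)²})^{|P_v⁽ᵏ⁾(τ)|}` with the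
WEIGHT `w_τ = (e^{−⅛ap(Lᵏε)²})^{|P_s⁽ᵏ⁾(τ)|}·e^{−¼γ₀p(Lᵏε)²|Q_s⁽ᵏ⁾(τ)|}·(e^{−p(Lᵏε)²})^{|R_s⁽ᵏ⁾(τ)|}` = the SCALAR small factors
of ζ′ (3.34) — the shape in which ζ″ comes out of this seat's vector-field theorems
(`B2Ineq340VectorFields.ineq340_core`, `B2Ineq340ZeroFieldConcrete.ineq340_zeroField(_knit)`: level factor
`Σ_τ w_{j,τ}·(e^{−¼γ₀r_j|Q_v|}e^{−¼γ₀r′_j|R_v|})·(e^{−⅛ar_j})^{|P_v|}` with `r_j = r′_j = p(Lʲε)²` and *"w ↤ the scalar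
factors of (3.34)"*), so that the ζ″ there IS (3.41) BY NAME; the companion of `B2Eq334ZetaPrimeKnit` (ζ′); a pure
finite-sum identity (theorems only)

statement-level skeleton of published theorems with citation tags; proofs where landed; nothing here is a claim about the Yang–Mills mass gap

CITATION HEADER.  T. Bałaban, *(Higgs)₂,₃ quantum fields in a finite volume. II. An upper bound*, Commun. Math. Phys.
**86** (1982) 555–594 [Balaban1982Higgs2] (cell paper B2; PDF held `paper:balaban1982-cmp86-higgs23-ii`, journal page =
PDF page + 554; pp. 591–592 read on the ×2 renders `…/1982-cmp86-higgs23-II-p037-x2.png`, `-p038-x2.png`).  Unit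
`lit-balaban-p15` gen 6 (Phase-2 proof seat p15; HOME `run/shared/lean/pub/lit-balaban/`).  SKELETON row **B2.Eq3.32**
member (3.41) (typed with body by r14 g3 `B2Eq341Zeta.zeta341`, p246287; fold owner r02).  USED BY NAME: r14's
`zeta341`, `zeta334`, `weight341`, `weight334`, `sortCard`, `prod_weight341`, `B2Sect3C.term341`,
`B2Eq29Resummation.minimals`; this seat's `B2Eq334ZetaPrimeKnit.{sortCard_scalarPart_of_lt, sortCard_scalarPart_of_not_lt}`.
Nothing restated.

THE SOURCE TEXT (verbatim, p. 591 l.−2 – p. 592 l.6): *"where ζ″_{Λ₀⁽ᵏ⁾} = Σ_{{P_v⁽ᵏ⁾,…,R_s⁽ᵏ⁾} admissible, minimal}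
exp(−⅛ap(Lᵏε)²|P_v⁽ᵏ⁾|)exp(−¼γ₀p(Lᵏε)²|Q_v⁽ᵏ⁾|)·exp(−¼γ₀p(Lᵏε)²|R_v⁽ᵏ⁾|) exp(−⅛ap(Lᵏε)²|P_s⁽ᵏ⁾|)·exp(−¼γ₀p(Lᵏε)²|Q_s⁽ᵏ⁾|)
exp(−p(Lᵏε)²|R_s⁽ᵏ⁾|). (3.41)"*; (3.34) p. 591: *"ζ′_{Λ₀⁽ᵏ⁾} = Σ_{{P_v⁽ᵏ⁾,…,R_s⁽ᵏ⁾} admissible, minimal} χᶜ_{P_v⁽ᵏ⁾}·χᶜ_{Q_v⁽ᵏ⁾}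
χᶜ_{R_v⁽ᵏ⁾} exp(−⅛ap(Lᵏε)²|P_s⁽ᵏ⁾|)·exp(−¼γ₀p(Lᵏε)²|Q_s⁽ᵏ⁾|) exp(−p(Lᵏε)²|R_s⁽ᵏ⁾|)"*.

DICTIONARY (r14's, `B2Eq341Zeta`/`B2Eq29Resummation`): a tuple `τ : Finset S` of elements with `sort x : Fin 6` (0 P_v,
1 Q_v, 2 R_v, 3 P_s, 4 Q_s, 5 R_s), `minimals N W` the minimal admissible tuples for `W = Λ₀⁽ᵏ⁾ᶜ`, `pk` ↤ `p(Lᵏε)`;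
`sortCard sort τ σ` = `|P_v⁽ᵏ⁾|, …, |R_s⁽ᵏ⁾|`.  In this seat's `ineq340_core` / `ineq340_zeroField_knit` the families of
level j are any finite type: take `ι j := ↥(minimals N_j W_j)`, `w_{j,τ} :=` the scalar weight below, `Q_v⁽ʲ⁾(τ)`,
`R_v⁽ʲ⁾(τ)`, `P_v⁽ʲ⁾(τ)` := the elements of sorts 1, 2, 0 (read as bonds of `Λ_j`, sites of `Λ_j`, output sites through
the injections of the concrete dictionary, so that their cardinalities are `sortCard τ 1`, `sortCard τ 2`, `sortCard τ 0`),
`r_j = r′_j := p(Lʲε)²`.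

WHAT IS PROVED.  `prod_scalarPart_weight334` (the scalar-sort part of a (3.34) summand, for ANY vector-field
indicators `c`, is the weight `w_τ`), **`zeta341_eq_familySum`**: `zeta341 N W sort a γ₀ pk = Σ_{τ ∈ minimals N W} w_τ ·
(e^{−¼γ₀pk²·#Q_v(τ)}·e^{−¼γ₀pk²·#R_v(τ)}) · (e^{−⅛a pk²})^{#P_v(τ)}`, `zeta341_eq_familySum_subtype` (the same over the
finite TYPE of minimal admissible tuples, the index type of the theorems), `prod_zeta341_eq_familySum` (the product
over the scales `j < K`, the shape of the first factor of `ineq340_zeroField_knit`'s right side).  HONEST SCOPE: an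
identity of finite sums; which lattice objects the elements of sorts 0/1/2 are is the concrete dictionary, as in
`B2Eq341Zeta` and `B2Eq334ZetaPrimeKnit`.
-/

namespace Literature.MathematicalPhysics.QuantumFieldTheory.Balaban1983to89.B2Eq341ZetaDoublePrimeKnit

open Finset
open scoped Classical
open B2Eq29Resummation B2Eq341Zeta B2Eq334ZetaPrimeKnit

noncomputable section

variable {S β : Type*}

/-- **The weight `w_τ`**: the scalar small factors `(e^{−⅛ap²})^{|P_s(τ)|}·e^{−¼γ₀p²|Q_s(τ)|}·(e^{−p²})^{|R_s(τ)|}` of a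
tuple ARE the scalar-sort part of its (3.34) summand, whatever the vector-field indicators `c` (*"w ↤ the scalar
factors of (3.34)"*). [cite: Balaban1982Higgs2, (3.34) p.591, (3.41) p.592] -/
theorem prod_scalarPart_weight334 (sort : S → Fin 6) (c : S → ℝ) (a γ₀ pk : ℝ) (τ : Finset S) :
    ∏ x ∈ τ.filter (fun x => ¬ (sort x : ℕ) < 3), weight334 sort c a γ₀ pk x
      = Real.exp (-(a * pk ^ 2 / 8)) ^ sortCard sort τ 3 * Real.exp (-(γ₀ * pk ^ 2 * (sortCard sort τ 4 : ℕ) / 4))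
        * Real.exp (-(pk ^ 2)) ^ sortCard sort τ 5 := by
  have h : ∏ x ∈ τ.filter (fun x => ¬ (sort x : ℕ) < 3), weight334 sort c a γ₀ pk x
      = ∏ x ∈ τ.filter (fun x => ¬ (sort x : ℕ) < 3), weight341 sort a γ₀ pk x :=
    Finset.prod_congr rfl fun x hx => by rw [weight334, if_neg (Finset.mem_filter.1 hx).2, weight341]
  rw [h, prod_weight341,
    sortCard_scalarPart_of_lt sort τ (σ := 0) (by decide), sortCard_scalarPart_of_lt sort τ (σ := 1) (by decide),
    sortCard_scalarPart_of_lt sort τ (σ := 2) (by decide),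
    sortCard_scalarPart_of_not_lt sort τ (σ := 3) (by decide), sortCard_scalarPart_of_not_lt sort τ (σ := 4) (by decide),
    sortCard_scalarPart_of_not_lt sort τ (σ := 5) (by decide)]
  simp only [B2Sect3C.term341, Nat.cast_zero, mul_zero, Real.exp_zero, one_mul]
  have h3 : Real.exp (-(a / 8) * pk ^ 2 * (sortCard sort τ 3 : ℕ))
      = Real.exp (-(a * pk ^ 2 / 8)) ^ sortCard sort τ 3 := by
    rw [← Real.exp_nat_mul]; congr 1; ring
  have h5 : Real.exp (-pk ^ 2 * (sortCard sort τ 5 : ℕ)) = Real.exp (-(pk ^ 2)) ^ sortCard sort τ 5 := by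
    rw [← Real.exp_nat_mul]; congr 1; ring
  have h4 : Real.exp (-(γ₀ / 4) * pk ^ 2 * (sortCard sort τ 4 : ℕ))
      = Real.exp (-(γ₀ * pk ^ 2 * (sortCard sort τ 4 : ℕ) / 4)) := by
    congr 1; ring
  rw [h3, h4, h5]

variable [Fintype S]

/-- **ζ″ (3.41) AS A FAMILY SUM**: `ζ″_{Λ₀⁽ᵏ⁾} = Σ_{τ admissible minimal} w_τ · (e^{−¼γ₀p²|Q_v⁽ᵏ⁾(τ)|}·e^{−¼γ₀p²|R_v⁽ᵏ⁾(τ)|}) ·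
(e^{−⅛ap²})^{|P_v⁽ᵏ⁾(τ)|}` with `w_τ = (e^{−⅛ap²})^{|P_s(τ)|}·e^{−¼γ₀p²|Q_s(τ)|}·(e^{−p²})^{|R_s(τ)|}` — the level factor
`Σ_τ w_{j,τ}·(e^{−¼γ₀r_j|Q_v|}e^{−¼γ₀r′_j|R_v|})·(e^{−⅛ar_j})^{|P_v|}` of `B2Ineq340VectorFields.ineq340_core` /
`B2Ineq340ZeroFieldConcrete.ineq340_zeroField_knit` (`r_j = r′_j = p(Lᵏε)²`) for r14's typed ζ″.
[cite: Balaban1982Higgs2, (3.41) p.592] -/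
theorem zeta341_eq_familySum (N : S → Finset β) (W : Finset β) (sort : S → Fin 6) (a γ₀ pk : ℝ) :
    zeta341 N W sort a γ₀ pk
      = ∑ τ ∈ minimals N W,
          (Real.exp (-(a * pk ^ 2 / 8)) ^ sortCard sort τ 3 * Real.exp (-(γ₀ * pk ^ 2 * (sortCard sort τ 4 : ℕ) / 4))
              * Real.exp (-(pk ^ 2)) ^ sortCard sort τ 5)
          * (Real.exp (-(γ₀ * pk ^ 2 * (sortCard sort τ 1 : ℕ) / 4))
              * Real.exp (-(γ₀ * pk ^ 2 * (sortCard sort τ 2 : ℕ) / 4)))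
          * Real.exp (-(a * pk ^ 2 / 8)) ^ sortCard sort τ 0 := by
  unfold zeta341
  refine Finset.sum_congr rfl fun τ _ => ?_
  rw [prod_weight341]
  simp only [B2Sect3C.term341]
  have h0 : Real.exp (-(a / 8) * pk ^ 2 * (sortCard sort τ 0 : ℕ))
      = Real.exp (-(a * pk ^ 2 / 8)) ^ sortCard sort τ 0 := by
    rw [← Real.exp_nat_mul]; congr 1; ring
  have h3 : Real.exp (-(a / 8) * pk ^ 2 * (sortCard sort τ 3 : ℕ))
      = Real.exp (-(a * pk ^ 2 / 8)) ^ sortCard sort τ 3 := by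
    rw [← Real.exp_nat_mul]; congr 1; ring
  have h5 : Real.exp (-pk ^ 2 * (sortCard sort τ 5 : ℕ)) = Real.exp (-(pk ^ 2)) ^ sortCard sort τ 5 := by
    rw [← Real.exp_nat_mul]; congr 1; ring
  have h1 : Real.exp (-(γ₀ / 4) * pk ^ 2 * (sortCard sort τ 1 : ℕ))
      = Real.exp (-(γ₀ * pk ^ 2 * (sortCard sort τ 1 : ℕ) / 4)) := by
    congr 1; ring
  have h2 : Real.exp (-(γ₀ / 4) * pk ^ 2 * (sortCard sort τ 2 : ℕ))
      = Real.exp (-(γ₀ * pk ^ 2 * (sortCard sort τ 2 : ℕ) / 4)) := by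
    congr 1; ring
  have h4 : Real.exp (-(γ₀ / 4) * pk ^ 2 * (sortCard sort τ 4 : ℕ))
      = Real.exp (-(γ₀ * pk ^ 2 * (sortCard sort τ 4 : ℕ) / 4)) := by
    congr 1; ring
  rw [h0, h1, h2, h3, h4, h5]
  ring

/-- The same over the finite TYPE of minimal admissible tuples — the family index type `ι j := ↥(minimals N_j W_j)` of
`ineq340_core` / `ineq340_zeroField_knit`. [cite: Balaban1982Higgs2, (3.41) p.592] -/
theorem zeta341_eq_familySum_subtype (N : S → Finset β) (W : Finset β) (sort : S → Fin 6) (a γ₀ pk : ℝ) :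
    zeta341 N W sort a γ₀ pk
      = ∑ τ : ↥(minimals N W),
          (Real.exp (-(a * pk ^ 2 / 8)) ^ sortCard sort τ.1 3 * Real.exp (-(γ₀ * pk ^ 2 * (sortCard sort τ.1 4 : ℕ) / 4))
              * Real.exp (-(pk ^ 2)) ^ sortCard sort τ.1 5)
          * (Real.exp (-(γ₀ * pk ^ 2 * (sortCard sort τ.1 1 : ℕ) / 4))
              * Real.exp (-(γ₀ * pk ^ 2 * (sortCard sort τ.1 2 : ℕ) / 4)))
          * Real.exp (-(a * pk ^ 2 / 8)) ^ sortCard sort τ.1 0 := by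
  rw [zeta341_eq_familySum, ← Finset.sum_coe_sort]

end

section Scales

variable {K : ℕ} {S β : Fin K → Type*} [∀ j, Fintype (S j)]

/-- **`Π_{k=0}^{K−1} ζ″_{Λ₀⁽ᵏ⁾}` of (3.40) AS THE PRODUCT OF FAMILY SUMS** — scale by scale (`S j`, `N j`, `W j = Λ₀⁽ʲ⁾ᶜ`,
`sort j`, `pk j = p(Lʲε)`): the first factor of the right side of `B2Ineq340ZeroFieldConcrete.ineq340_zeroField_knit`
with `ι j := ↥(minimals (N j) (W j))`, the scalar weights, `r_j = r′_j = p(Lʲε)²` and `|Q_v|, |R_v|, |P_v|` the sort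
counts. [cite: Balaban1982Higgs2, (3.40)–(3.41) pp.591–592] -/
theorem prod_zeta341_eq_familySum (N : (j : Fin K) → S j → Finset (β j)) (W : (j : Fin K) → Finset (β j))
    (sort : (j : Fin K) → S j → Fin 6) (a γ₀ : ℝ) (pk : Fin K → ℝ) :
    ∏ j : Fin K, zeta341 (N j) (W j) (sort j) a γ₀ (pk j)
      = ∏ j : Fin K, ∑ τ : ↥(minimals (N j) (W j)),
          (Real.exp (-(a * pk j ^ 2 / 8)) ^ sortCard (sort j) τ.1 3
              * Real.exp (-(γ₀ * pk j ^ 2 * (sortCard (sort j) τ.1 4 : ℕ) / 4))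
              * Real.exp (-(pk j ^ 2)) ^ sortCard (sort j) τ.1 5)
          * (Real.exp (-(γ₀ * pk j ^ 2 * (sortCard (sort j) τ.1 1 : ℕ) / 4))
              * Real.exp (-(γ₀ * pk j ^ 2 * (sortCard (sort j) τ.1 2 : ℕ) / 4)))
          * Real.exp (-(a * pk j ^ 2 / 8)) ^ sortCard (sort j) τ.1 0 :=
  Finset.prod_congr rfl fun j _ => by
    classical
    exact zeta341_eq_familySum_subtype (N j) (W j) (sort j) a γ₀ (pk j)

end Scales

end Literature.MathematicalPhysics.QuantumFieldTheory.Balaban1983to89.B2Eq341ZetaDoublePrimeKnit
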